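import Summits.BirchSwinnertonDyer.BirchSwinnertonDyer.Theorems.ResidualThetaTransportAtTwoSignedMuSeedAtTwoPlusLayerZero
import Summits.BirchSwinnertonDyer.BirchSwinnertonDyer.Theorems.ResidualThetaTransportAtTwoSignedMuSeedAtTwoPlusLayerGlue
import Literature.NumberTheory.EllipticCurves.IwasawaTowerTorsionProofs
import Literature.NumberTheory.EllipticCurves.IwasawaSelmerControlKernelProofs
import HarnessLib

/-!
# Seed crux `SignedMuSeedAtTwoPlus` (stmt-BirchSwinnertonDyer-21438): `h_n : H¹(ℚ_n, A[2^∞]) → H¹(ℚ_∞, A[2^∞])` is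
# INJECTIVE at every layer for a good-supersingular-at-2 curve, and the LOWER half of finite-layer control —
# `#Sel⁺(A/ℚ_n)[2] ≤ #Sel⁺(A/ℚ_∞)[2, (γ−1)^{2^n}]`

Cell `bsd-wall`, width seat `bsd-wall-rtt-p4-w3` (g3). THEOREMS ONLY (no `def`, no named fact, no `sorry`); helper
`--supports` the seed crux (= `stub_residualSeedAtTwo` of line `birth` of Kμ⁺ stmt-BirchSwinnertonDyer-20689); BSD is not proved
by this. Sequel of `…LayerZero` (the layer `0` case, stub S5) for EVERY layer `n`:

* `two_smul_eq_zero_imp_eq_zero_of_goodSS` — `A(ℚ)[2] = 0` at good supersingular `2` (`P2.irr_two_of_goodSS_two`);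
  `natCard_ker_layerToInfty_eq_one`, **`layerToInfty_injective`** — `#ker h_n = #A[2^∞]^{Gal(ℚ̄/ℚ_n)} = 1` for all `n`:
  `A[2^∞]^{Gal(ℚ̄/ℚ_∞)} = 0` by the fixed-point principle (a pro-`2` group acting on a non-zero `2`-group fixes a non-zero
  point; tree `fixedPoints_kerSubgroup_geomPrimaryTorsion_eq_bot`), and `Gal(ℚ̄/ℚ_∞) ≤ Gal(ℚ̄/ℚ_n)`; Greenberg's count
  `natCard_ker_layerToInfty_eq_natCard_fixedPoints`.
* `conj_pow_eq_of_mem_range_layerToInfty` — a class restricted from `ℚ_n` is fixed by `conj_γ^{2^n}` (`γ^{2^n} ∈ Gal(ℚ̄/ℚ_n)`).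
* **`natCard_signedSelmerLayer_twoTorsion_le`** — for the cyclotomic-type datum (`κ` any `ℤ₂`-extension of `ℚ`, `γ` a
  topological generator): `#{c ∈ Sel⁺(A/ℚ_n) : 2c = 0} ≤ #{s ∈ Sel⁺(A/ℚ_∞) : 2s = 0, (conj_γ − 1)^{2^n} s = 0}` whenever the
  right side is finite — the LOWER half of the dictionary «`fixedTwoTorsion(2^n)` = plus `2`-Selmer of `A` over `ℚ_n`» of line
  `fukuda-step` (and of S4/S6 of line `layer-rank-certificate` at `q = 2^n`); the UPPER half is control proper (local
  conditions + `coker`), not touched. Frobenius on the `2`-torsion (`LayerDual.pow_two_pow_apply_eq_self_iff`) converts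
  «fixed by `conj_γ^{2^n}`» into «killed by `(conj_γ − 1)^{2^n}`».

References: [GreenbergLNM1716] §1 p. 62, §3 Lemma 3.2 (p. 86), §4 Lemma 4.3 (p. 103), Prop. 4.8 (p. 109); [Kobayashi2003] Def. 1.1;
[Fukuda1994] Thm. 1.
-/

set_option autoImplicit false
set_option linter.dupNamespace false

noncomputable section

open scoped Classical NumberField

open WeierstrassCurve Literature.NumberTheory.EllipticCurves Literature.NumberTheory.EllipticCurves.IwasawaAlgebra
  Literature.NumberTheory.EllipticCurves.Kobayashi2003 Literature.NumberTheory.EllipticCurves.Rank1Residual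
  Literature.NumberTheory.EllipticCurves.IwasawaDual ZpExtension

namespace Summit.BirchSwinnertonDyer.BirchSwinnertonDyer.Theorems.SignedMuAtTwo.LayerZero

variable (A : WeierstrassCurve ℚ) [A.IsElliptic] [A.IsGloballyMinimal]

/-- **`A(ℚ)[2] = 0` at good supersingular `2`** (`A[2]` is irreducible: a rational `2`-torsion point would reduce to a point
of order `2` of `Ã(𝔽₂)`, which has odd order). [cite: Kobayashi2003, Prop. 8.7] -/
theorem two_smul_eq_zero_imp_eq_zero_of_goodSS (hss : GoodSS A 2) : ∀ P : A.toAffine.Point, 2 • P = 0 → P = 0 := by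
  intro P hP
  have h := (Summit.BirchSwinnertonDyer.Rank1Residual.X5.O1.irr_two_iff_forall_two_nsmul A).mp
    (Summit.BirchSwinnertonDyer.Rank1Residual.P2.irr_two_of_goodSS_two A hss) P
  apply h
  convert hP

/-- **`#ker h_n = 1` at every layer** for `A/ℚ` good supersingular at `2` and any `ℤ₂`-extension `κ` of `ℚ`:
`#ker h_n = #A[2^∞]^{Gal(ℚ̄/ℚ_n)}` and `A[2^∞]^{Gal(ℚ̄/ℚ_∞)} = 0` (fixed-point principle, `A(ℚ)[2] = 0`).
[cite: GreenbergLNM1716, §1 p. 62 and §4 Lemma 4.3 (p. 103), Prop. 4.8 (p. 109)] -/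
theorem natCard_ker_layerToInfty_eq_one (hss : GoodSS A 2) (κ : ZpExtension ℚ 2) (n : ℕ) :
    Nat.card (A.layerToInfty κ n).ker = 1 := by
  haveI := A.finite_fixedPoints_kerSubgroup_geomPrimaryTorsion_rat κ (p := 2)
  rw [A.natCard_ker_layerToInfty_eq_natCard_fixedPoints κ n]
  have hbot := A.fixedPoints_kerSubgroup_geomPrimaryTorsion_eq_bot κ (p := 2)
    (fun P hP ↦ two_smul_eq_zero_imp_eq_zero_of_goodSS A hss P (by convert hP))
  have hset : {m : geomPrimaryTorsion A 2 | ∀ σ ∈ κ.layerSubgroup n, σ • m = m} = {0} := by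
    ext m
    simp only [Set.mem_setOf_eq, Set.mem_singleton_iff]
    constructor
    · intro hm
      have hmem : m ∈ FixedPoints.addSubgroup κ.kerSubgroup (geomPrimaryTorsion A 2) := by
        rw [FixedPoints.mem_addSubgroup]
        rintro ⟨τ, hτ⟩
        rw [Subgroup.mk_smul]
        exact hm τ (κ.kerSubgroup_le_layerSubgroup n hτ)
      rw [hbot] at hmem
      exact (AddSubgroup.mem_bot).mp hmem
    · rintro rfl σ _
      exact smul_zero σ
  rw [hset, Nat.card_unique]

/-- **`h_n` is injective at every layer** (good supersingular `2`). [cite: GreenbergLNM1716, §3 Lemma 3.2 (p. 86)] -/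
theorem layerToInfty_injective (hss : GoodSS A 2) (κ : ZpExtension ℚ 2) (n : ℕ) :
    Function.Injective (A.layerToInfty κ n) := by
  rw [injective_iff_map_eq_zero]
  intro y hy
  have hbot : (A.layerToInfty κ n).ker = ⊥ := AddSubgroup.eq_bot_of_card_eq _ (natCard_ker_layerToInfty_eq_one A hss κ n)
  have : y ∈ (A.layerToInfty κ n).ker := (AddMonoidHom.mem_ker).mpr hy
  rw [hbot] at this
  exact (AddSubgroup.mem_bot).mp this

omit [A.IsElliptic] [A.IsGloballyMinimal] in
/-- `conj_{σ^k} = (conj_σ)^k` on `Sel^ε(E/K_∞)` (iterate `conjH1_mul`). [folklore] -/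
theorem conjSignedSelmerInfty_pow_apply (κ : ZpExtension ℚ 2) (σ : Field.absoluteGaloisGroup ℚ) (k : ℕ)
    (s : signedSelmerInfty A κ 1) :
    (((conjSignedSelmerInfty A κ 1 σ) ^ k) s : A.subgroupH1 2 κ.kerSubgroup) =
      A.conjH1 2 κ.kerSubgroup (σ ^ k) (s : A.subgroupH1 2 κ.kerSubgroup) := by
  induction k generalizing s with
  | zero => rw [pow_zero, pow_zero, A.conjH1_one_holds 2 κ.kerSubgroup, AddMonoid.End.one_apply, AddMonoidHom.id_apply]
  | succ k ih =>
    rw [pow_succ, pow_succ, AddMonoid.End.coe_mul, Function.comp_apply, ih, coe_conjSignedSelmerInfty_apply,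
      A.conjH1_mul_holds 2 κ.kerSubgroup, AddMonoidHom.comp_apply]

omit [A.IsElliptic] [A.IsGloballyMinimal] in
/-- **A class restricted from `ℚ_n` is fixed by `conj_γ^{2^n}`**: the image of `h_n` lies in the `Gal(ℚ̄/ℚ_n)`-invariants
(`range_layerToInfty_le_layerInvariants_holds`) and `γ^{2^n} ∈ Gal(ℚ̄/ℚ_n)` (`pow_mem_layerSubgroup`).
[cite: GreenbergLNM1716, §1 Thm. 1.2 and §3 p. 86] -/
theorem conj_pow_eq_of_mem_range_layerToInfty (κ : ZpExtension ℚ 2) {γ : Field.absoluteGaloisGroup ℚ}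
    (hγ : κ.IsTopGenerator γ) (n : ℕ) (y : A.subgroupH1 2 (κ.layerSubgroup n)) :
    A.conjH1 2 κ.kerSubgroup (γ ^ 2 ^ n) (A.layerToInfty κ n y) = A.layerToInfty κ n y := by
  have hinv : A.layerToInfty κ n y ∈ A.layerInvariants κ n := A.range_layerToInfty_le_layerInvariants_holds κ n ⟨_, rfl⟩
  exact (A.mem_layerInvariants_iff κ n _).mp hinv _ (κ.pow_mem_layerSubgroup hγ n)

/-- **The LOWER half of finite-layer control for `Sel⁺` at `2`: `#Sel⁺(A/ℚ_n)[2] ≤ #Sel⁺(A/ℚ_∞)[2, (γ−1)^{2^n}]`** (the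
right side finite), for `A/ℚ` globally minimal, good supersingular at `2`, any `ℤ₂`-extension `κ` of `ℚ` with topological
generator `γ`: `h_n` is injective (`layerToInfty_injective`), maps `Sel⁺(A/ℚ_n)` into `Sel⁺(A/ℚ_∞)`
(`map_layerToInfty_signedSelmerLayer_le`), and its image is fixed by `conj_γ^{2^n}`, i.e. killed by `(conj_γ − 1)^{2^n}` on the
`2`-torsion (Frobenius). [cite: GreenbergLNM1716, §3 Lemma 3.2 (p. 86)] [cite: Kobayashi2003, Def. 1.1] [cite: Fukuda1994, Thm. 1] -/
theorem natCard_signedSelmerLayer_twoTorsion_le (hss : GoodSS A 2) (κ : ZpExtension ℚ 2) {γ : Field.absoluteGaloisGroup ℚ}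
    (hγ : κ.IsTopGenerator γ) (n : ℕ)
    (hfin : {s : signedSelmerInfty A κ 1 |
      2 • s = 0 ∧ ((conjSignedSelmerInfty A κ 1 γ - 1) ^ (2 ^ n : ℕ)) s = 0}.Finite) :
    Nat.card {c : signedSelmerLayer A κ 1 n // 2 • c = 0} ≤
      Nat.card {s : signedSelmerInfty A κ 1 // 2 • s = 0 ∧ ((conjSignedSelmerInfty A κ 1 γ - 1) ^ (2 ^ n : ℕ)) s = 0} := by
  haveI : Finite {s : signedSelmerInfty A κ 1 //
      2 • s = 0 ∧ ((conjSignedSelmerInfty A κ 1 γ - 1) ^ (2 ^ n : ℕ)) s = 0} := hfin.to_subtype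
  have hmem : ∀ c : signedSelmerLayer A κ 1 n,
      A.layerToInfty κ n (c : A.subgroupH1 2 (κ.layerSubgroup n)) ∈ signedSelmerInfty A κ 1 := fun c ↦
    map_layerToInfty_signedSelmerLayer_le A κ 1 n ⟨c, c.2, rfl⟩
  have h2 : ∀ c : signedSelmerLayer A κ 1 n, 2 • c = 0 →
      2 • (⟨A.layerToInfty κ n (c : A.subgroupH1 2 (κ.layerSubgroup n)), hmem c⟩ : signedSelmerInfty A κ 1) = 0 := by
    intro c hc
    apply Subtype.ext
    change 2 • A.layerToInfty κ n (c : A.subgroupH1 2 (κ.layerSubgroup n)) = 0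
    rw [← map_nsmul, ← AddSubgroupClass.coe_nsmul, hc, ZeroMemClass.coe_zero, map_zero]
  have hkill : ∀ c : signedSelmerLayer A κ 1 n, 2 • c = 0 →
      ((conjSignedSelmerInfty A κ 1 γ - 1) ^ (2 ^ n : ℕ))
        ⟨A.layerToInfty κ n (c : A.subgroupH1 2 (κ.layerSubgroup n)), hmem c⟩ = 0 := by
    intro c hc
    rw [← LayerDual.pow_two_pow_apply_eq_self_iff _ n _ (h2 c hc)]
    apply Subtype.ext
    rw [conjSignedSelmerInfty_pow_apply]
    exact conj_pow_eq_of_mem_range_layerToInfty A κ hγ n _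
  let f : {c : signedSelmerLayer A κ 1 n // 2 • c = 0} →
      {s : signedSelmerInfty A κ 1 // 2 • s = 0 ∧ ((conjSignedSelmerInfty A κ 1 γ - 1) ^ (2 ^ n : ℕ)) s = 0} := fun c ↦
    ⟨⟨A.layerToInfty κ n (c.1 : A.subgroupH1 2 (κ.layerSubgroup n)), hmem c.1⟩, ⟨h2 c.1 c.2, hkill c.1 c.2⟩⟩
  have hf : Function.Injective f := by
    rintro ⟨c, hc⟩ ⟨c', hc'⟩ h
    have h1 : A.layerToInfty κ n (c : A.subgroupH1 2 (κ.layerSubgroup n)) =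
        A.layerToInfty κ n (c' : A.subgroupH1 2 (κ.layerSubgroup n)) :=
      congrArg (fun s : {s : signedSelmerInfty A κ 1 //
          2 • s = 0 ∧ ((conjSignedSelmerInfty A κ 1 γ - 1) ^ (2 ^ n : ℕ)) s = 0} ↦
        ((s.1 : signedSelmerInfty A κ 1) : A.subgroupH1 2 κ.kerSubgroup)) h
    exact Subtype.ext (Subtype.ext (layerToInfty_injective A hss κ n h1))
  exact Nat.card_le_card_of_injective f hf

/-- **The same in line `fukuda-step`'s currency** («fixed by `conj_γ^{2^n}`»):
`#Sel⁺(A/ℚ_n)[2] ≤ #{s ∈ Sel⁺(A/ℚ_∞) : 2s = 0, conj_γ^{2^n} s = s}` (right side finite). [cite: Fukuda1994, Thm. 1]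
[cite: GreenbergLNM1716, §3 Lemma 3.2 (p. 86)] -/
theorem natCard_signedSelmerLayer_twoTorsion_le_fixed (hss : GoodSS A 2) (κ : ZpExtension ℚ 2)
    {γ : Field.absoluteGaloisGroup ℚ} (hγ : κ.IsTopGenerator γ) (n : ℕ)
    (hfin : {s : signedSelmerInfty A κ 1 | 2 • s = 0 ∧ ((conjSignedSelmerInfty A κ 1 γ) ^ (2 ^ n : ℕ)) s = s}.Finite) :
    Nat.card {c : signedSelmerLayer A κ 1 n // 2 • c = 0} ≤
      Nat.card {s : signedSelmerInfty A κ 1 | 2 • s = 0 ∧ ((conjSignedSelmerInfty A κ 1 γ) ^ (2 ^ n : ℕ)) s = s} := by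
  have hconv : Nat.card {s : signedSelmerInfty A κ 1 | 2 • s = 0 ∧ ((conjSignedSelmerInfty A κ 1 γ) ^ (2 ^ n : ℕ)) s = s} =
      Nat.card {s : signedSelmerInfty A κ 1 //
        2 • s = 0 ∧ ((conjSignedSelmerInfty A κ 1 γ - 1) ^ (2 ^ n : ℕ)) s = 0} := by
    refine Nat.card_congr (Equiv.subtypeEquivRight fun s ↦ ?_)
    change (2 • s = 0 ∧ ((conjSignedSelmerInfty A κ 1 γ) ^ (2 ^ n : ℕ)) s = s) ↔ _
    constructor
    · rintro ⟨hs, hc⟩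
      exact ⟨hs, (LayerDual.pow_two_pow_apply_eq_self_iff _ n s hs).mp hc⟩
    · rintro ⟨hs, hc⟩
      exact ⟨hs, (LayerDual.pow_two_pow_apply_eq_self_iff _ n s hs).mpr hc⟩
  have hfin' : {s : signedSelmerInfty A κ 1 |
      2 • s = 0 ∧ ((conjSignedSelmerInfty A κ 1 γ - 1) ^ (2 ^ n : ℕ)) s = 0}.Finite := by
    refine Set.Finite.subset hfin fun s hs ↦ ?_
    exact ⟨hs.1, (LayerDual.pow_two_pow_apply_eq_self_iff _ n s hs.1).mpr hs.2⟩
  rw [hconv]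
  exact natCard_signedSelmerLayer_twoTorsion_le A hss κ hγ n hfin'

end Summit.BirchSwinnertonDyer.BirchSwinnertonDyer.Theorems.SignedMuAtTwo.LayerZero

end
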